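/-
Copyright (c) 2026. All rights reserved.
Released under Apache 2.0 license as described in the file LICENSE.
Authors: abc-iut cell, prover seat abc-iut-w4-d095 (gen 7; row «SB′-CONTACT», abc-iut-L4-lead m136), over abc-iut-w5-d144's
statement `LogFrobeniusMonoTelecoreObservables` (p484312), abc-iut-f-101's telecore/contact files, abc-iut-L4-t3's
`LogFrobeniusMonoTelecoreIotaContact` and this seat's bricks (nothing of those files is restated); `⋉`-twin re-elaborated by prover seat
abc-iut-L4-t11 (gen 15) per the cell recipe LTIMES-RECIPE (owner abc-iut-L4-t3), statements unchanged.
-/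
import Literature.AnabelianGeometry.AbsoluteAnabelian.Ltimes.LogFrobeniusMonoTelecoreLamCross
import Literature.AnabelianGeometry.AbsoluteAnabelian.Ltimes.LogFrobeniusMonoTelecoreObservables
import Literature.AnabelianGeometry.AbsoluteAnabelian.LogFrobeniusMonoTelecoreContactObservables
import HarnessLib

/-!
# [AbsTopIII] Corollary 5.10 (iv)(c), observable clause: `ℋ_{An⊢}` is compatible with the `Γ⃗×_v`-indexed homotopies of `S_log`, `S_log⊞` — SUFFICIENCY

S. Mochizuki, *Topics in absolute anabelian geometry III: global reconstruction algorithms*,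
J. Math. Sci. Univ. Tokyo 22 (2015) 939–1156 [MochizukiAbsTopIII2015]; manuscript `paper:url-5493eb38cbb7`: Cor 5.10
(iv)(c) p. 148 l. 39–51 ("… generate a contact structure `ℋ_{An⊢}` on `𝔗_{An⊢}` that is compatible with … the homotopies of
the observables `S_log`, `S_log⊞` of Corollary 5.5, (iii), that arise from the `ι⊞_{v,ε}`, `ι_{v,ε}` indexed by `ε ∈ Γ⃗×_v` [not
`Γ⃗^log_v`!]"), Def 3.5 (ii) p. 75 ("compatible" = contained in ONE family of homotopies, with the same homotopies), (iv)
p. 76, Cor 5.5 (iii) p. 131, Def 5.4 (iii)/(vii) pp. 126–128.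

WHY THIS FILE (row «SB′-CONTACT»: the CLOSER of abc-iut-w5-d144's typed statement
`LogFrobeniusSetting.Cor510MonoContactObservablesCompatible` — the (c)-clause twin of `s_b′`, flip condition (1) of the
L4 count for [AbsTopIII] Cor 5.10 (iv); PROOF-SIDE, nothing of the statement files restated).  ONE family of homotopies
on the telecore diagram `D_{An⊢}` containing the telecore family `𝒥`, the contact structure `ℋ_{An⊢}` (with the printed pairs
`(γ¹_{v,ν}, γ⁰_{v,ν})` and — a fortiori — abc-iut-L4-t3's `ι^{An⊢⊞}`-pairs) AND the embedded observable pairs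
`([λ⊞_{v,ν₁}], [λ⊞_{v,ν₂}])`, `([λ_{v,ν₁}], [λ_{v,ν₂}])` of `S_log⊞`, `S_log` for every edge `ε : ν₁ → ν₂` of `Γ⃗×_v`:

* `obsRelLifts` — the UNION (`DiagramRelativeFamiliesUnion`) of abc-iut-L4-t3's extended relative lifts `monoRelLiftsIota`
  (`W = {An⊢} ∪ {𝒩⊢⊞_v}`) with this seat's `lamRelLifts` (`{𝒩⊞_v}`), glued by the cross laws of `LogFrobeniusMonoTelecoreLamCross`;
  ★ `monoContactObs` — its family of homotopies `K′`;
* `monoContactIota_sub_monoContactObs`, `jfam_sub_monoContactObs`, `monoContactObs_isContactStructure`,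
  `monoContactObs_pairs` — `K′ ⊇ ℋ_{An⊢} ⊇ 𝒥` with the same homotopies; `K′` is a contact structure containing the printed pairs;
* `eta_app_heq_iotaCore_of_isLogObservablePlus/TS` — in ANY observable structure `S_log⊞_v` / `S_log_v` (typed
  `IsLogObservablePlus/TS`) the homotopy of the core-edge generator pair is `ι⊞_{v,ε}` resp. `ι⊞_{v,ε}` pushed to `𝒩_v`
  (clause (2) pins it componentwise; `TSHomotopies.iota_toTS`);
* `monoContactObs_coreEdgesPlus`, `monoContactObs_coreEdgesTS` — the embedded `Γ⃗×_v`-indexed observable pairs lie in `K′` with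
  the same homotopies (`CoreEdgesCompatibleInMonoTelecorePlus/TS`);
* ★ `cor510MonoContactObservablesCompatible_of` — **SUFFICIENCY: (a) `hN` + (c) `hψ` + (d) `hη` + coherence `hcoh` +
  `ι^{An⊢⊞}`-data `I` with its square + the `η⊢`-naturality square `EtaNaturalAt` + `IotaOver` + observable structures
  `S_log⊞_v`, `S_log_v` at every `v` ⇒ `Cor510MonoContactObservablesCompatible L TS`** (`V(F_mod) ≠ ∅`); the packaged form
  `MonoTelecoreCoherence.cor510MonoContactObservablesCompatible_of` over `(M, K, I)` with `Cor55Observables`,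
  `Cor55ObservablesTS`; `…_iff_nonempty` with abc-iut-w5-d144's degenerate corner.

Hypotheses are the typed binders / add-ons BY NAME (abc-iut-f-101, abc-iut-L4-t3); no new Prop fact.  The instance at the
genuine open-augmentation carrier is a separate file.  Refereed pre-IUT material; OUR constructions; nothing here bears on
[IUTchIII] Cor. 3.12; no side taken; typed ≠ proved.

**`⋉`-TWIN (cell row «LTIMES-SUCCESSOR», L4-lead m162; typing finding T3g9-F1).**  This file is the verbatim
re-elaboration of `LogFrobeniusMonoTelecoreContactObservables.lean` over the successor interface `LogFrobeniusSettingLtimes`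
(`Ltimes/LogFrobeniusCompatibility.lean`: `ι⊞_{v,ε}` indexed by the edges of `Γ⃗^⋉_v` at EVERY place, [AbsTopIII] Cor 5.5 (iii)
p. 131), produced by the cell recipe `LTIMES-RECIPE.md`: names carry over inside `namespace LogFrobeniusSettingLtimes`, the
section variable is `Lt`, setting-independent declarations are NOT repeated (the originals are in scope), statements and
proofs are otherwise unchanged.  The original file over the frozen interface stays as it is.
-/

set_option autoImplicit false

universe u

open CategoryTheory Quiver

namespace Literature.AnabelianGeometry.AbsoluteAnabelian

namespace LogFrobeniusSettingLtimes

-- setting-independent declarations of the original file (namespace `LogFrobeniusSetting`) re-exposed under the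
-- successor namespace (recipe rule 5); the originals are imported, not repeated.
export LogFrobeniusSetting (map_heq_of_eq_of_heq)

variable {Vmod : Type u} {isArc : Vmod → Bool} (Lt : LogFrobeniusSettingLtimes Vmod isArc)

  (hN : ∀ v : Vmod, Lt.monoN v ⋙ Lt.toEmono v ≅ Lt.toE v ⋙ Lt.monoAn)
  (hψ : ∀ (w : Vmod) (j : {ν : LogVertex (isArc w) // ν.IsCross}),
    Lt.ψAnMono w j ⋙ Lt.forgetMono w ⋙ Lt.toEmono w ≅ Lt.κAnMono.inverse)
  (hη : ∀ (v : Vmod) (ν : LogVertex (isArc v)) (hν : ν.IsCross),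
    Lt.lam v ν ⋙ Lt.forget v ⋙ Lt.toE v ⋙ Lt.monoAn ⋙ Lt.κAnMono.functor ⋙ Lt.ψAnMono v ⟨ν, hν⟩ ≅ Lt.lam v ν ⋙ Lt.monoNplus v)
  (I : Lt.IotaAnMono hψ)

-- the coherence hypothesis `hcoh`: «`η⊢_{v,ν}` lies over `ℰ⊢`» (abc-iut-f-101's binder, verbatim)
variable (hcoh : ∀ (v : Vmod) (ν : LogVertex (isArc v)) (hν : ν.IsCross) (y : Lt.X),
  (Lt.toEmono v).map ((Lt.forgetMono v).map ((hη v ν hν).hom.app y)) ≫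
    (Lt.toEmono v).map ((Lt.monoHomotopy v).hom.app ((Lt.lam v ν).obj y)) ≫
      (hN v).hom.app ((Lt.forget v).obj ((Lt.lam v ν).obj y)) =
  (hψ v ⟨ν, hν⟩).hom.app ((Lt.lam v ν ⋙ Lt.forget v ⋙ Lt.toE v ⋙ Lt.monoAn ⋙ Lt.κAnMono.functor).obj y) ≫
    Lt.κAnMono.unitIso.inv.app ((Lt.lam v ν ⋙ Lt.forget v ⋙ Lt.toE v ⋙ Lt.monoAn).obj y))
  (hsq : ∀ v : Vmod, Lt.IotaCoreSquaresCommute v) (hsqI : I.SquaresCommute) (hEta : I.EtaNaturalAt hη) (hιO : Lt.IotaOver)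

/-! ## The glued relative lifts and the family `K′` -/

include hcoh hEta hιO in
/-- **the glued relative lifts**: abc-iut-L4-t3's extended contact data at `{An⊢} ∪ {𝒩⊢⊞_v}` ∪ this seat's `ι⊞`-data at `{𝒩⊞_v}`
(disjoint vertex sets; the cross laws of `LogFrobeniusMonoTelecoreLamCross`). [cite: MochizukiAbsTopIII2015, Definition 3.5 (ii) p.75] -/
noncomputable def obsRelLifts : Lt.monoTeleDiagram.RelLifts :=
  DiagramOfCategories.RelLifts.union (R₁ := Lt.monoRelLiftsIota hN hψ hη I hcoh hsqI) (R₂ := Lt.lamRelLifts hsq)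
    (fun w hm hn => nw_mw_disjoint w hn hm) (Lt.mwCrossLaw hN hψ hη I hcoh hsq hsqI)
    (Lt.lamCrossLaw hN hψ hη I hcoh hsq hsqI hEta hιO)

include hcoh hEta hιO in
/-- ★ **the family `K′` on `D_{An⊢}`**: ONE family of homotopies containing `𝒥`, `ℋ_{An⊢}` and the `Γ⃗×_v`-indexed `ι⊞`-pairs (Def 3.5
(ii): identity / composition / whiskering PROVED by abc-iut-L4-t5's `relFamily`). [cite: MochizukiAbsTopIII2015, Cor 5.10 (iv)(c) p.148] -/
noncomputable def monoContactObs : Lt.monoTeleDiagram.HomotopyFamily :=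
  DiagramOfCategories.relFamily (Lt.obsRelLifts hN hψ hη I hcoh hsq hsqI hEta hιO)

/-! ## `K′` contains `ℋ_{An⊢}` (with the `ι^{An⊢⊞}`-pairs), hence `𝒥`; it is a contact structure with the printed pairs -/

include hcoh hEta hιO in
/-- **`K′ ⊇ ℋ_{An⊢}`** (abc-iut-L4-t3's `monoContactIota`, the left summand) with the same homotopies.
[cite: MochizukiAbsTopIII2015, Definition 3.5 (ii) p.75] -/
theorem monoContactIota_sub_monoContactObs :
    SubFamily (Lt.monoContactIota hN hψ hη I hcoh hsqI) (Lt.monoContactObs hN hψ hη I hcoh hsq hsqI hEta hιO) :=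
  fun _ _ P Q h => DiagramOfCategories.RelLifts.relFamily_sub_union_left _ _ _ P Q h

include hcoh hEta hιO in
/-- **`K′ ⊇ 𝒥`**, the telecore family of `𝔗_{An⊢}` (through `ℋ_{An⊢} ⊇ 𝒥`, abc-iut-L4-t3 / abc-iut-f-101).
[cite: MochizukiAbsTopIII2015, Definition 3.5 (iv) p.76] -/
theorem jfam_sub_monoContactObs [Nonempty Vmod] :
    SubFamily (Lt.monoTelecore hN hψ).Jfam (Lt.monoContactObs hN hψ hη I hcoh hsq hsqI hEta hιO) := by
  intro a b P Q h
  obtain ⟨h', e⟩ := Lt.monoContactIota_sub_monoContactObs hN hψ hη I hcoh hsq hsqI hEta hιO P Q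
    (Lt.monoContactIota_E_of_jfam hN hψ hη I hcoh hsqI h)
  exact ⟨h', (Lt.monoTelecore_η_eq_iota hN hψ hη I hcoh hsqI h).trans e⟩

include hcoh hEta hιO in
/-- **`K′` is a contact structure for `𝔗_{An⊢}`** (Def 3.5 (iv): compatible with `𝒥` — witnessed by `K′` itself).
[cite: MochizukiAbsTopIII2015, Definition 3.5 (iv) p.76] -/
theorem monoContactObs_isContactStructure [Nonempty Vmod] :
    DiagramOfCategories.Telecore.IsContactStructure _ (Lt.monoTelecore hN hψ)
      (Lt.monoContactObs hN hψ hη I hcoh hsq hsqI hEta hιO) := by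
  refine ⟨Lt.monoContactObs hN hψ hη I hcoh hsq hsqI hEta hιO, fun i => ?_⟩
  cases i
  · exact ⟨fun _ _ p q h => (Lt.jfam_sub_monoContactObs hN hψ hη I hcoh hsq hsqI hEta hιO p q h).1,
      fun _ _ p q h => (Lt.jfam_sub_monoContactObs hN hψ hη I hcoh hsq hsqI hEta hιO p q h).2⟩
  · exact ⟨fun _ _ _ _ h => h, fun _ _ _ _ _ => rfl⟩

include hcoh hEta hιO in
/-- **the printed pairs `(γ¹_{v,ν}, γ⁰_{v,ν})`, in both orders, are boundary pairs of `K′`.** [cite: MochizukiAbsTopIII2015, Cor 5.10 (iv)(c) p.148] -/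
theorem monoContactObs_pairs (v : Vmod) (ν : LogVertex (isArc v)) (hν : ν.IsCross) :
    (Lt.monoContactObs hN hψ hη I hcoh hsq hsqI hEta hιO).E (gammaOne v ν hν) (gammaZero v ν hν) ∧
      (Lt.monoContactObs hN hψ hη I hcoh hsq hsqI hEta hιO).E (gammaZero v ν hν) (gammaOne v ν hν) :=
  ⟨DiagramOfCategories.RelLifts.relE_union_of_left _ _ _ (Lt.monoContactIota_pairs hN hψ hη I hcoh hsqI v ν hν).1,
    DiagramOfCategories.RelLifts.relE_union_of_left _ _ _ (Lt.monoContactIota_pairs hN hψ hη I hcoh hsqI v ν hν).2⟩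

include hcoh hEta hιO in
/-- the `ι^{An⊢⊞}`-pairs `([φ_{ν₁}], [φ_{ν₂}])` are boundary pairs of `K′` too, with homotopy `ι^{An⊢⊞}_{v,ε}` (abc-iut-L4-t3's
`monoContactIota_iota` carried along the inclusion; recorded for the `F-0139″` bookkeeping). [cite: MochizukiAbsTopIII2015, Cor 5.10 (iv)(c) p.148] -/
theorem monoContactObs_iota (v : Vmod) {ν₁ ν₂ : LogVertex (isArc v)} (ε : LogEdgeTS (isArc v) ν₁ ν₂) (hε : ε.InCore) :
    ∃ h : (Lt.monoContactObs hN hψ hη I hcoh hsq hsqI hEta hιO).E (telPath v ν₁ hε.isCross_src) (telPath v ν₂ hε.isCross_tgt),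
      HEq ((Lt.monoContactObs hN hψ hη I hcoh hsq hsqI hEta hιO).η h) (I.ι v ε hε) := by
  obtain ⟨h', e⟩ := Lt.monoContactIota_sub_monoContactObs hN hψ hη I hcoh hsq hsqI hEta hιO _ _
    (Lt.monoContactIota_E_telPath hN hψ hη I hcoh hsqI v ε hε)
  exact ⟨h', e ▸ Lt.monoContactIota_iota hN hψ hη I hcoh hsqI v ε hε⟩

/-! ## The core-edge generator pairs of the observables -/

section Generators

variable {v : Vmod}

/-- two `ι⊞`-carrying edges with the same endpoints give the same `ι⊞`-component (there is at most one such edge).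
[cite: MochizukiAbsTopIII2015, Def 5.4 (vii) p. 128] -/
theorem iota_app_eq_of_subsingleton {ν₁ ν₂ : LogVertex (isArc v)} (ε ε' : LogEdgeLtimes (isArc v) ν₁ ν₂) (X₀ : Lt.X) :
    (Lt.iota v ε).app X₀ = (Lt.iota v ε').app X₀ :=
  congrArg (fun e => (Lt.iota v e).app X₀) (LogEdgeLtimes.subsingleton_edge _ ε ε')

/-- **in ANY observable structure `S_log⊞_v` the homotopy of the generator pair `([λ⊞_{v,ν₁}], [λ⊞_{v,ν₂}])` of a core edge is the
untwisted `ι⊞_{v,ε}`**, componentwise (clause (2) of `IsLogObservablePlus` pins it; one homotopy per pair).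
[cite: MochizukiAbsTopIII2015, Cor 5.5 (iii) p. 131] -/
theorem eta_app_heq_iotaCore_of_isLogObservablePlus (H : (Lt.logDiagramPlus v).HomotopyFamily)
    (hH : Lt.IsLogObservablePlus v H) {ν₁ ν₂ : LogVertex (isArc v)} (ε : LogEdgeLtimes (isArc v) ν₁ ν₂) (hε : ε.toTS.InCore)
    (h₁ : ν₁.isPostLog = false) (h₂ : ν₂.isPostLog = false) (h : H.E (lamPath v ν₁ h₁) (lamPath v ν₂ h₂)) (X₀ : Lt.X) :
    (H.η h).app X₀ ≍ (Lt.iotaCore v ε.toTS hε).app X₀ := by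
  obtain ⟨hmem, hc⟩ := hH.2.1 ν₁ ν₂ ε h₁ h₂
  obtain ⟨hobj, hobj', e⟩ := hc X₀
  change (H.η hmem).app X₀ ≍ _
  rw [e]
  refine (eqToHom_comp_heq _ _).trans ((comp_eqToHom_heq _ _).trans ?_)
  exact (heq_of_eq (Lt.iota_app_eq_of_subsingleton ε hε.toLogEdgeLtimes X₀)).trans
    (Lt.iotaPre_app_heq v hε.toLogEdgeLtimes hε.isCross_src.1 X₀).symm

/-- **in ANY observable structure `S_log_v` the homotopy of the generator pair `([λ_{v,ν₁}], [λ_{v,ν₂}])` of a core edge is `ι⊞_{v,ε}`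
pushed down to `𝒩_v`**, componentwise (clause (2) of `IsLogObservableTS`; on `Γ⃗^⋉_v` the `TS`-valued `ι` IS `ι⊞` composed with
`𝒩⊞_v → 𝒩_v`, `TSHomotopies.iota_toTS`). [cite: MochizukiAbsTopIII2015, Cor 5.5 (iii) p. 131] -/
theorem eta_app_heq_iotaCore_of_isLogObservableTS (T : Lt.TSHomotopies) (H : (Lt.logDiagramTS v).HomotopyFamily)
    (hH : Lt.IsLogObservableTS T v H) {ν₁ ν₂ : LogVertex (isArc v)} (ε : LogEdgeTS (isArc v) ν₁ ν₂) (hε : ε.InCore)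
    (h₁ : ν₁.isPostLog = false) (h₂ : ν₂.isPostLog = false) (h : H.E (lamPathTS v ν₁ h₁) (lamPathTS v ν₂ h₂)) (X₀ : Lt.X) :
    (H.η h).app X₀ ≍ (Lt.forget v).map ((Lt.iotaCore v ε hε).app X₀) := by
  obtain ⟨hmem, hc⟩ := hH.2.1 ν₁ ν₂ ε h₁ h₂
  obtain ⟨hobj, hobj', e⟩ := hc X₀
  change (H.η hmem).app X₀ ≍ _
  rw [e]
  refine (eqToHom_comp_heq _ _).trans ((comp_eqToHom_heq _ _).trans ?_)
  have hT : (T.iota v ε).app X₀ = (Lt.forget v).map ((Lt.iota v hε.toLogEdgeLtimes).app X₀) := by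
    have := congrArg (fun e => (T.iota v e).app X₀) (LogEdgeTS.InCore.toLogEdgeLtimes_toTS hε).symm
    rw [this, T.iota_toTS]
    rfl
  rw [hT]
  exact map_heq' (Lt.forget v) (congrArg (fun F => F.obj X₀) (Lt.twist_comp_lam_eq v ν₁ hε.isCross_src.1)) rfl
    (Lt.iotaPre_app_heq v hε.toLogEdgeLtimes hε.isCross_src.1 X₀).symm

end Generators

/-! ## The embedded observable pairs lie in `K′` with the same homotopies -/

section Embedded

variable {v : Vmod}

include hcoh hEta hιO in
/-- the embedded generator pair `([λ⊞_{v,ν₁}], [λ⊞_{v,ν₂}])` of a core edge is a boundary pair of `K′`, with homotopy `θN` (the right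
summand at `𝒩⊞_v`). [cite: MochizukiAbsTopIII2015, Cor 5.10 (iv)(c) p.148] -/
theorem monoContactObs_E_lamE (v : Vmod) {ν₁ ν₂ : LogVertex (isArc v)} (ε : LogEdgeTS (isArc v) ν₁ ν₂) (hε : ε.InCore) :
    ∃ h : (Lt.monoContactObs hN hψ hη I hcoh hsq hsqI hEta hιO).E
        (Path.nil.cons (lamE v ν₁ hε.isCross_src)) (Path.nil.cons (lamE v ν₂ hε.isCross_tgt)),
      (Lt.monoContactObs hN hψ hη I hcoh hsq hsqI hEta hιO).η h = Lt.θN (nrelN_lamE (isArc := isArc) v ε hε) := by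
  have hr : (Lt.lamRelLifts hsq).Rel (Path.nil.cons (lamE v ν₁ hε.isCross_src)) (Path.nil.cons (lamE v ν₂ hε.isCross_tgt)) :=
    nrelN_lamE (isArc := isArc) v ε hε
  refine ⟨DiagramOfCategories.RelLifts.relE_union_of_right _ _ _
    (DiagramOfCategories.relE_of_rel (Lt.lamRelLifts hsq) (w := nplusVx v) (nw_nplusVx (isArc := isArc) v) hr), ?_⟩
  exact DiagramOfCategories.RelLifts.relFamily_union_η_eq_θ_right _ _ _ (nw_nplusVx (isArc := isArc) v) hr _

/-- the functor of the observable path `[λ⊞_{v,ν}]` of `S_log⊞_v` is that of the embedded path `[λ⊞_{v,ν}]` of `D_{An⊢}` (both are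
`λ⊞_{v,ν}`). [cite: MochizukiAbsTopIII2015, Cor 5.10 (iv)(b) p. 148] -/
theorem pathFunctor_lamPath_eq_tele (ν : LogVertex (isArc v)) (hν : ν.IsCross) :
    (Lt.logDiagramPlus v).pathFunctor (lamPath v ν hν.1) = Lt.monoTeleDiagram.pathFunctor (Path.nil.cons (lamE v ν hν)) := by
  refine (Lt.pathFunctor_lamPath' v ν hν.1).symm.trans ?_
  rw [DiagramOfCategories.pathFunctor_cons, Lt.monoTeleDiagram.pathFunctor_nil]
  exact (Functor.id_comp _).symm

/-- the functor of the observable path `[λ_{v,ν}]` of `S_log_v` is that of the embedded path of `D_{An⊢}` (both are `λ⊞_{v,ν}` then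
`𝒩⊞_v → 𝒩_v`). [cite: MochizukiAbsTopIII2015, Cor 5.10 (iv)(b) p. 148] -/
theorem pathFunctor_lamPathTS_eq_tele (ν : LogVertex (isArc v)) (hν : ν.IsCross) :
    (Lt.logDiagramTS v).pathFunctor (lamPathTS v ν hν.1) =
      Lt.monoTeleDiagram.pathFunctor ((Path.nil.cons (lamE v ν hν)).cons (forgetE v)) := by
  -- (⋉-twin: the exported frozen `lamPathTS` lives on the frozen `logShapeTS`, definitionally the shape of `Lt.logDiagramTS v`;
  -- `erw` sees through the copied `obsShape` of `Ltimes/LogFrobeniusCorollaries`, where the original used `rw`.)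
  erw [lamPathTS, DiagramOfCategories.pathFunctor_cons, DiagramOfCategories.pathFunctor_cons,
    (Lt.logDiagramTS v).pathFunctor_nil, DiagramOfCategories.pathFunctor_cons, DiagramOfCategories.pathFunctor_cons,
    Lt.monoTeleDiagram.pathFunctor_nil]
  rfl

include hcoh hEta hιO in
/-- ★ **the `Γ⃗×_v`-indexed pairs of `S_log⊞_v` lie in `K′` with the same homotopies** (`CoreEdgesCompatibleInMonoTelecorePlus`), for ANY
observable structure `S_log⊞_v`. [cite: MochizukiAbsTopIII2015, Cor 5.10 (iv)(c) p.148] -/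
theorem monoContactObs_coreEdgesPlus [Nonempty Vmod] (v : Vmod) (H : (Lt.logDiagramPlus v).HomotopyFamily)
    (hH : Lt.IsLogObservablePlus v H) :
    Lt.CoreEdgesCompatibleInMonoTelecorePlus (Lt.monoTelecore hN hψ).J (Lt.monoTelecore hN hψ).telMap
      (Lt.monoContactObs hN hψ hη I hcoh hsq hsqI hEta hιO) v H := by
  intro ν₁ ν₂ ε hε h₁ h₂ h
  obtain ⟨h', e'⟩ := Lt.monoContactObs_E_lamE hN hψ hη I hcoh hsq hsqI hEta hιO v ε.toTS hε
  refine ⟨h', HEq.trans ?_ (heq_of_eq e'.symm)⟩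
  refine natTrans_heq_of_app (Lt.pathFunctor_lamPath_eq_tele ν₁ hε.isCross_src) (Lt.pathFunctor_lamPath_eq_tele ν₂ hε.isCross_tgt)
    fun X₀ => ?_
  exact (Lt.eta_app_heq_iotaCore_of_isLogObservablePlus H hH ε hε h₁ h₂ h X₀).trans
    (Lt.θN_lamE_app_heq v ε.toTS hε (nrelN_lamE (isArc := isArc) v ε.toTS hε) X₀).symm

include hcoh hEta hιO in
/-- ★ **the `Γ⃗×_v`-indexed pairs of `S_log_v` lie in `K′` with the same homotopies** (`CoreEdgesCompatibleInMonoTelecoreTS`): the embedded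
pair `([λ_{v,ν₁}], [λ_{v,ν₂}])` decomposes through `𝒩⊞_v` with suffix `𝒩⊞_v → 𝒩_v`, so its `K′`-homotopy is `θN ▷ (𝒩⊞_v → 𝒩_v)` = `ι⊞_{v,ε}`
pushed down. [cite: MochizukiAbsTopIII2015, Cor 5.10 (iv)(c) p.148] -/
theorem monoContactObs_coreEdgesTS [Nonempty Vmod] (v : Vmod) (T : Lt.TSHomotopies) (H : (Lt.logDiagramTS v).HomotopyFamily)
    (hH : Lt.IsLogObservableTS T v H) :
    Lt.CoreEdgesCompatibleInMonoTelecoreTS (Lt.monoTelecore hN hψ).J (Lt.monoTelecore hN hψ).telMap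
      (Lt.monoContactObs hN hψ hη I hcoh hsq hsqI hEta hιO) v H := by
  intro ν₁ ν₂ ε hε h₁ h₂ h
  have hr : (Lt.lamRelLifts hsq).Rel (Path.nil.cons (lamE v ν₁ hε.isCross_src)) (Path.nil.cons (lamE v ν₂ hε.isCross_tgt)) :=
    nrelN_lamE (isArc := isArc) v ε hε
  -- the decomposition through `𝒩⊞_v` with suffix `[𝒩⊞_v → 𝒩_v]`
  let d : DiagramOfCategories.RDecomp (Lt.obsRelLifts hN hψ hη I hcoh hsq hsqI hEta hιO)
      ((Path.nil.cons (lamE v ν₁ hε.isCross_src)).cons (forgetE v)) ((Path.nil.cons (lamE v ν₂ hε.isCross_tgt)).cons (forgetE v)) :=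
    ⟨nplusVx v, Or.inr (nw_nplusVx (isArc := isArc) v), Path.nil.cons (lamE v ν₁ hε.isCross_src),
      Path.nil.cons (lamE v ν₂ hε.isCross_tgt), Path.nil.cons (forgetE v), Or.inr ⟨nw_nplusVx (isArc := isArc) v, hr⟩, rfl, rfl⟩
  have e' : (Lt.monoContactObs hN hψ hη I hcoh hsq hsqI hEta hιO).η ⟨d⟩ = d.η (Lt.obsRelLifts hN hψ hη I hcoh hsq hsqI hEta hιO) :=
    DiagramOfCategories.relFamily_η_eq _ ⟨d⟩ d
  refine ⟨⟨d⟩, HEq.trans ?_ (heq_of_eq e'.symm)⟩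
  -- the decomposition homotopy is `θN ▷ 𝒟_[[𝒩⊞_v → 𝒩_v]]`
  have hθ : (Lt.obsRelLifts hN hψ hη I hcoh hsq hsqI hEta hιO).θ d.mem d.rel = Lt.θN (nrelN_lamE (isArc := isArc) v ε hε) :=
    DiagramOfCategories.RelLifts.union_θ_right _ _ _ (nw_nplusVx (isArc := isArc) v) _ hr _
  refine natTrans_heq_of_app (Lt.pathFunctor_lamPathTS_eq_tele ν₁ hε.isCross_src)
    (Lt.pathFunctor_lamPathTS_eq_tele ν₂ hε.isCross_tgt) fun X₀ => ?_
  refine (Lt.eta_app_heq_iotaCore_of_isLogObservableTS T H hH ε hε h₁ h₂ h X₀).trans ?_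
  rw [DiagramOfCategories.RDecomp.η, NatTrans.comp_app, NatTrans.comp_app, eqToHom_app, eqToHom_app,
    Functor.whiskerRight_app, hθ]
  refine HEq.symm ((eqToHom_comp_heq _ _).trans ((comp_eqToHom_heq _ _).trans ?_))
  -- `𝒟_[[𝒩⊞_v → 𝒩_v]](θN_{X₀}) ≍ (𝒩⊞_v → 𝒩_v)(ι⊞_{v,ε,X₀})`
  have hF : Lt.monoTeleDiagram.pathFunctor (Path.nil.cons (forgetE (isArc := isArc) v)) = Lt.forget v := by
    rw [DiagramOfCategories.pathFunctor_cons, Lt.monoTeleDiagram.pathFunctor_nil]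
    exact Functor.id_comp _
  exact map_heq_of_eq_of_heq hF (Functor.congr_obj (Lt.pathFunctor_lamPath_eq_tele ν₁ hε.isCross_src).symm X₀ |>.trans
      (Functor.congr_obj (Lt.pathFunctor_lamPath' v ν₁ hε.isCross_src.1).symm X₀))
    (Functor.congr_obj (Lt.pathFunctor_lamPath_eq_tele ν₂ hε.isCross_tgt).symm X₀ |>.trans
      (Functor.congr_obj (Lt.pathFunctor_lamPath' v ν₂ hε.isCross_tgt.1).symm X₀))
    (Lt.θN_lamE_app_heq v ε hε (nrelN_lamE (isArc := isArc) v ε hε) X₀)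

end Embedded

/-! ## Sufficiency -/

include hcoh in
/-- ★ **SUFFICIENCY for abc-iut-w5-d144's `Cor510MonoContactObservablesCompatible`** (Cor 5.10 (iv)(c), observable clause), for
`V(F_mod) ≠ ∅`: GIVEN (a) the rows-4→5 mono-analyticization homotopies `hN`, (c) "`ψ^{An⊢⊞}` over `ℰ⊢`" `hψ`, (d) the printed
`η⊢_{v,ν}` `hη` with its coherence `hcoh`, `ι^{An⊢⊞}`-data `I` with the square of Def 5.4 (iii) (`I.SquaresCommute`), abc-iut-L4-t3's
`η⊢`-naturality square `EtaNaturalAt` and add-on `IotaOver`, and observable structures `S_log⊞_v`, `S_log_v` at every `v` — the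
telecore `𝔗_{An⊢}` (abc-iut-f-101), the contact structure `K′ ⊇ ℋ_{An⊢}` with the printed pairs, and the `Γ⃗×_v`-indexed observable
pairs all lie in the ONE family `K′`. [cite: MochizukiAbsTopIII2015, Cor 5.10 (iv)(c) p.148] -/
theorem cor510MonoContactObservablesCompatible_of [Nonempty Vmod] (TS : Lt.TSHomotopies)
    (Hplus : ∀ v : Vmod, (Lt.logDiagramPlus v).HomotopyFamily) (Hts : ∀ v : Vmod, (Lt.logDiagramTS v).HomotopyFamily)
    (hobs : ∀ v : Vmod, Lt.IsLogObservablePlus v (Hplus v) ∧ Lt.IsLogObservableTS TS v (Hts v))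
    (hsqI : I.SquaresCommute) (hEta : I.EtaNaturalAt hη) (hιO : Lt.IotaOver) :
    Lt.Cor510MonoContactObservablesCompatible TS := by
  have hsq : ∀ v : Vmod, Lt.IotaCoreSquaresCommute v :=
    fun v => Lt.iotaCoreSquaresCommute_of_isLogObservablePlus v (Hplus v) (hobs v).1
  refine ⟨_, _, Lt.monoCoreObs_isCore hN, Lt.monoTelecore hN hψ, rfl, HEq.rfl,
    Lt.monoContactObs hN hψ hη I hcoh hsq hsqI hEta hιO,
    Lt.monoContactObs_isContactStructure hN hψ hη I hcoh hsq hsqI hEta hιO, ?_, Hplus, Hts,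
    Lt.monoContactObs hN hψ hη I hcoh hsq hsqI hEta hιO, hobs,
    Lt.jfam_sub_monoContactObs hN hψ hη I hcoh hsq hsqI hEta hιO, fun _ _ p q h => ⟨h, rfl⟩, fun v => ⟨?_, ?_⟩⟩
  · intro v ν hν hcore hnp hnv he5 hem hnm
    exact Lt.monoContactObs_pairs hN hψ hη I hcoh hsq hsqI hEta hιO v ν hν
  · exact Lt.monoContactObs_coreEdgesPlus hN hψ hη I hcoh hsq hsqI hEta hιO v (Hplus v) (hobs v).1
  · exact Lt.monoContactObs_coreEdgesTS hN hψ hη I hcoh hsq hsqI hEta hιO v TS (Hts v) (hobs v).2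

/-- ★ **SUFFICIENCY over the add-ons** `(M, K, I)`: a setting with `V(F_mod) ≠ ∅` carrying the mono-analyticization homotopies `M`,
abc-iut-L4-t3's coherence add-on `K` (printed `η⊢`), `ι^{An⊢⊞}`-data `I` with its square and the `η⊢`-naturality square
`K.EtaNatural I`, the add-on `IotaOver`, and observable structures `S_log⊞`, `S_log` (Cor 5.5 (iii) as typed:
`Cor55Observables`, `Cor55ObservablesTS TS`) satisfies `Cor510MonoContactObservablesCompatible TS` — binders fed BY NAME.
[cite: MochizukiAbsTopIII2015, Cor 5.10 (iv)(c) p.148] -/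
theorem MonoTelecoreCoherence.cor510MonoContactObservablesCompatible_of {Lt : LogFrobeniusSettingLtimes Vmod isArc}
    {M : Lt.MonoAnalyticizationHomotopies} (K : Lt.MonoTelecoreCoherence M) (I : K.IotaData) [Nonempty Vmod]
    (hsqI : I.SquaresCommute) (hE : K.EtaNatural I) (hιO : Lt.IotaOver) (TS : Lt.TSHomotopies)
    (hplus : Lt.Cor55Observables) (hts : Lt.Cor55ObservablesTS TS) : Lt.Cor510MonoContactObservablesCompatible TS :=
  Lt.cor510MonoContactObservablesCompatible_of M.toE K.psiOver K.eta I K.eta_over TS (fun v => (hplus v).choose)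
    (fun v => (hts v).choose) (fun v => ⟨(hplus v).choose_spec, (hts v).choose_spec⟩) hsqI hE hιO

/-- the statement at such a setting EXACTLY: it holds iff `V(F_mod) ≠ ∅` (abc-iut-w5-d144's degenerate corner
`not_cor510MonoContactObservablesCompatible_of_isEmpty`). [cite: MochizukiAbsTopIII2015, Cor 5.10 (iv)(c) p.148] -/
theorem MonoTelecoreCoherence.cor510MonoContactObservablesCompatible_iff_nonempty {Lt : LogFrobeniusSettingLtimes Vmod isArc}
    {M : Lt.MonoAnalyticizationHomotopies} (K : Lt.MonoTelecoreCoherence M) (I : K.IotaData)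
    (hsqI : I.SquaresCommute) (hE : K.EtaNatural I) (hιO : Lt.IotaOver) (TS : Lt.TSHomotopies)
    (hplus : Lt.Cor55Observables) (hts : Lt.Cor55ObservablesTS TS) :
    Lt.Cor510MonoContactObservablesCompatible TS ↔ Nonempty Vmod := by
  refine ⟨fun h => ?_, fun ⟨v⟩ => ?_⟩
  · by_contra hne
    haveI : IsEmpty Vmod := not_nonempty_iff.mp hne
    exact Lt.not_cor510MonoContactObservablesCompatible_of_isEmpty TS h
  · haveI : Nonempty Vmod := ⟨v⟩
    exact K.cor510MonoContactObservablesCompatible_of I hsqI hE hιO TS hplus hts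

end LogFrobeniusSettingLtimes

end Literature.AnabelianGeometry.AbsoluteAnabelian
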